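import Summits.ResolutionOfSingularities.ResolutionOfSingularities.Theorems.PurelyInseparableDim4SwapRelation
import Summits.ResolutionOfSingularities.ResolutionOfSingularities.Theorems.PurelyInseparableDim4JetInverse
import Mathlib.LinearAlgebra.Matrix.Determinant.Basic
import HarnessLib
import HarnessLib.Audit.Tags

/-!
# Purely inseparable four-folds — the unit class has an invertible 1-jet; readings of a re-presented state (cell `res-dim4-pi`,
# K2(p) lane, brick «swap normalisation», FILE SN4a)

[OURS · counted 0 · cell `res-dim4-pi` · seat res-dim4-p-7 g3 · desk WORD #116.]  Nothing here proves K2(p), `NoIsolatedTrap p p`, or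
resolution of singularities in dimension ≥ 4 / characteristic `p`.  AI kernel work, weaker than expert review.

* `isUnit_det_unitClass`: the 1-jet of a unit-class substitution (`θ (π i) = x_i e_i`, `θ (π f) = x_f e_f + G`) is the permutation
  `π` of a diagonal-plus-one-row matrix, determinant `± ∏ e_i(0) ≠ 0` — the hypothesis of res-dim4-p-11 g3's JET INVERSE FUNCTION
  THEOREM `JetInverse.exists_approx_inverse` (J1);
* **`read_of_rel`**: a presented state `B` related to an honest isolated band state `A` (`ℛ_π(A.F, B.F)` at a level `M` past `A`'s
  isolation certificate) is isolated with the same `ord₀`.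
* `step_r_apply`: the multiplicities of a step, letter by letter (bookkeeping for the window).
bears_on: LADDER-RESOLUTION:D157-DOOR2 (res-dim4-pi · K2(p) · swap normalisation SN4a).  Supports
stmt-ResolutionOfSingularities-16155 (helper).
-/

set_option linter.dupNamespace false -- mandated namespace of this single-conjunct summit

noncomputable section

namespace Summit.ResolutionOfSingularities.ResolutionOfSingularities.Theorems.PIDim4

namespace SwapNorm

open MvPolynomial Finset
open Literature.AlgebraicGeometry.Resolution
open Literature.AlgebraicGeometry.Resolution.CentreBlowup
open Literature.AlgebraicGeometry.Resolution.Hauser2010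

variable {K : Type} [Field K]

/-! ## §1 The 1-jet of a unit-class substitution -/

/-- `∂_k (x_i · e)(0) = [k = i] · e(0)`. [folklore] -/
theorem coeff_single_X_mul_eq (i k : Fin 4) (e : MvPolynomial (Fin 4) K) :
    coeff (Finsupp.single k 1) (X i * e) = if k = i then constantCoeff e else 0 := by
  classical
  by_cases hki : k = i
  · subst hki
    rw [if_pos rfl, coeff_X_mul', if_pos (by rw [Finsupp.mem_support_iff, Finsupp.single_eq_same]; exact one_ne_zero),
      tsub_self, ← constantCoeff_eq]
  · rw [if_neg hki]
    exact coeff_single_X_mul (Ne.symm hki) e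

/-- **The 1-jet of a unit-class substitution is invertible**: `det (∂θ_i/∂x_k (0)) = sign π · ∏ e_i(0)`, a unit.
[folklore] -/
theorem isUnit_det_unitClass {π : Equiv.Perm (Fin 4)} {f : Fin 4} {θ e : Fin 4 → MvPolynomial (Fin 4) K}
    {G : MvPolynomial (Fin 4) K} (hθi : ∀ i, i ≠ f → θ (π i) = X i * e i) (hθf : θ (π f) = X f * e f + G)
    (he : ∀ i, constantCoeff (e i) ≠ 0) (hG1 : coeff (Finsupp.single f 1) G = 0) :
    IsUnit (Matrix.det (Matrix.of fun i k => coeff (Finsupp.single k 1) (θ i))) := by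
  classical
  set L : Matrix (Fin 4) (Fin 4) K := Matrix.of fun i k => coeff (Finsupp.single k 1) (θ i) with hL
  -- rows re-indexed by `π`: diagonal plus the free row
  set D : Matrix (Fin 4) (Fin 4) K := Matrix.diagonal fun i => constantCoeff (e i) with hD
  have hB : L.submatrix π id = D.updateRow f (D f + fun k => coeff (Finsupp.single k 1) G) := by
    ext i k
    rw [Matrix.submatrix_apply, id, hL, Matrix.of_apply, Matrix.updateRow_apply]
    by_cases hi : i = f
    · subst hi
      rw [if_pos rfl, hθf, coeff_add, Pi.add_apply, coeff_single_X_mul_eq, hD, Matrix.diagonal_apply]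
      by_cases hk : k = i
      · subst hk; simp only [if_true]
      · rw [if_neg hk, if_neg (Ne.symm hk)]
    · rw [if_neg hi, hθi i hi, coeff_single_X_mul_eq, hD, Matrix.diagonal_apply]
      by_cases hk : k = i
      · subst hk; simp only [if_true]
      · rw [if_neg hk, if_neg (Ne.symm hk)]
  have hdetB : (L.submatrix π id).det = ∏ i, constantCoeff (e i) := by
    rw [hB, Matrix.det_updateRow_add, Matrix.updateRow_eq_self, hD, Matrix.det_diagonal,
      Matrix.det_eq_zero_of_column_eq_zero f, add_zero]
    intro i
    rw [Matrix.updateRow_apply]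
    by_cases hi : i = f
    · subst hi; rw [if_pos rfl, hG1]
    · rw [if_neg hi, Matrix.diagonal_apply, if_neg hi]
  have hdet : L.det = Equiv.Perm.sign π * ∏ i, constantCoeff (e i) := by
    have h := Matrix.det_permute π L
    rw [hdetB] at h
    have hs : ((Equiv.Perm.sign π : ℤ) : K) * ((Equiv.Perm.sign π : ℤ) : K) = 1 := by
      rw [← Int.cast_mul, ← Units.val_mul, Int.units_mul_self, Units.val_one, Int.cast_one]
    calc L.det = ((Equiv.Perm.sign π : ℤ) : K) * (((Equiv.Perm.sign π : ℤ) : K) * L.det) := by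
          rw [← mul_assoc, hs, one_mul]
      _ = _ := by rw [← h]
  rw [hdet]
  refine isUnit_iff_ne_zero.mpr (mul_ne_zero ?_ (Finset.prod_ne_zero_iff.mpr fun i _ => he i))
  rcases Int.units_eq_one_or (Equiv.Perm.sign π) with h | h <;> rw [h] <;> simp

/-! ## §2 Readings of a re-presented state -/

section Read

variable (p : ℕ) [hp : Fact p.Prime] [CharP K p]

/-- **A re-presented state reads like the honest one**: if `ℛ_π(A.F, B.F)` holds at a level `M ≥ N + p + 1`, where
`𝔪₀ᴺ ≤ J_p⁺(A.F) + 𝔪₀ᴺ⁺¹` certifies the isolation of `A`, and `ord₀ A.F = o` with `p ∤ o`, `o < M`, then `B` is isolated with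
`ord₀ B.F = o` (the inverse of `θ` modulo `𝔪₀ᴹ` is p-11's jet inverse function theorem `JetInverse.exists_approx_inverse`).
[folklore] -/
theorem read_of_rel
    {π : Equiv.Perm (Fin 4)} {f : Fin 4} {M N o : ℕ} {FA FB : MvPolynomial (Fin 4) K}
    {θ e : Fin 4 → MvPolynomial (Fin 4) K} {G U E : MvPolynomial (Fin 4) K}
    (hθi : ∀ i, i ≠ f → θ (π i) = X i * e i) (hθf : θ (π f) = X f * e f + G)
    (he : ∀ i, constantCoeff (e i) ≠ 0) (hG0 : constantCoeff G = 0) (hG1 : coeff (Finsupp.single f 1) G = 0)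
    (hU : constantCoeff U ≠ 0) (hE : E ∈ originIdeal K ^ M) (hrel : FB = deletePthPowers p (U ^ p * aeval θ FA) + E)
    (hiso : IsIsolated p FA) (hN : originIdeal K ^ N ≤ singLocusIdeal p FA ⊔ originIdeal K ^ (N + 1))
    (hM : N + p + 1 ≤ M) (ho : ordZero FA = o) (hpo : ¬ p ∣ o) (hoM : o < M) :
    IsIsolated p FB ∧ ordZero FB = o := by
  have hθ0 : ∀ i, constantCoeff (θ i) = 0 := unitClass_origin hθi hθf hG0
  obtain ⟨θ', hθ'0, hθθ', hθ'θ⟩ := JetInverse.exists_approx_inverse θ hθ0 (isUnit_det_unitClass hθi hθf he hG1) M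
  exact ⟨isIsolated_of_rel p hθ0 hθ'0 hθθ' hθ'θ hU hE hrel hiso.1 hN hM,
    ordZero_of_rel p hθ0 hθ'0 hθ'θ hU hE hrel ho hpo hoM⟩

end Read

/-! ## §3 The multiplicities of a step, letter by letter -/

/-- `(step q univ j b s).r i`: the chart letter gets `ord F − q`, a translated letter gets `0`, the others keep `r_i`.
[cite: Hauser2010, §F (transform D')] [folklore] -/
theorem step_r_apply [DecidableEq K] (q : ℕ) (j : Fin 4) (b : Fin 4 → K) (s : State K) (i : Fin 4) :
    (CentreBlowup.step q Finset.univ j b s).r i =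
      if i = j then (ordAlong Finset.univ s.F).toNat - q else if b i = 0 then s.r i else 0 := by
  change newMult q Finset.univ j b s i = _
  unfold newMult
  rw [Finsupp.update_apply]
  split_ifs with hij hb
  · rfl
  · rw [Finsupp.filter_apply, if_pos hb]
  · rw [Finsupp.filter_apply, if_neg hb]

end SwapNorm

end Summit.ResolutionOfSingularities.ResolutionOfSingularities.Theorems.PIDim4

end
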